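import Summits.QuantumFields.BalabanUV.T4Continuum.Support.NE7EnergySliceSupFlatSite
import Summits.QuantumFields.BalabanUV.T4Continuum.Support.NE3NestedBlockMeanCovariance
import Summits.QuantumFields.BalabanUV.T4Continuum.Support.NE3QbarIterNearFlat
import Summits.QuantumFields.BalabanUV.T4Continuum.Support.NE7MeanZeroGaugeSupPoincare
import HarnessLib

/-!
# NE7NestedExtNearFlat — THE NESTED COVARIANT BLOCK-CONSTANT EXTENSION IS GAUGE COVARIANT AND, AT A NEAR-FLAT TOWER, CLOSE TO THE PLAIN ONE:
# `nestedExt (W^u) (Ad_{u(M•·)} g) = Ad_u (nestedExt W g)` and `‖nestedExt L (j+1) V g y − g(blk_{L^{j+1}} y)‖ ≤ (Π_i (1 + 2d(L−1)δ_i) − 1)·‖g(blk y)‖ ≤ 4d(L−1)(Σ_i δ_i)·‖g(blk y)‖`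
# when the `i`-fold averaged backgrounds are within `δ_i` of `1` on the combs above `y` (memo ROAD-G100 §4, brick (C3) of THE CURVED SUP LETTER (L))

Cell `pub-balaban`, rung (B)+1 sub-cell t4, lineage `b2b-balaban-t4-ne7-p1`, generation 101 (CRUX PROVER NE7 #1 = OWNER of BINDER row NE7).  Memo
`t4/b2b-balaban-t4-ne7-p1-g101/ROAD-G101.md` §4.  WHY.  In the local bootstrap the divergence of the gauged slice element `Y′ = dirGauge u Y` is `f = covDiv (W^u) Y′ = Ad_u (covDiv W Y)`
(`Spine/NE3/SlicePoincareSlicB8Gauge.covDiv_gaugeAct`) `= Ad_u (nestedExt_W g) = nestedExt_{W^u} (Ad_{u(M•·)} g)` (§2), and what the flat letter charges is the distance of `f` from FLAT block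
constants, i.e. the oscillation of a nested extension AT THE NEAR-FLAT BACKGROUND `W^u` within a block (§3–§4): one transported tree contour per level, each within `l1(res)·δ_i ≤ d(L−1)δ_i` of
the identity (`NE3NestedBlockMeanCovariance.norm_hol_treeWord_sub_one_le`), so the nested transport is within `Π_i(1 + 2d(L−1)δ_i) − 1` of the identity.  With `δ_i ≲ L^i·δ + loopRad`-sums
(`NE3QbarIterNearFlat.norm_cavgIter_sub_one_le_tower`) and `M·δ ≍ K₀·M²x`, the oscillation is `O(K₀ε₁)·‖g‖` — absorbable, since `‖g‖ = O(S∕M)` (`NE7EnergySliceDivergenceSup`).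
WHAT ([folklore]; 0 def, 0 sorry; every `d`).  §1 **`covExt_gaugeAct`** (any `u`, any `W`, no smallness).  §2 **`nestedExt_gaugeAct`** (multi-level small-field class, unitary `u`).  §3 `norm_covExt_sub_le`
(one level: `‖covExt L V f x − f(blk_L x)‖ ≤ 2·l1(res_L x)·b·‖f(blk_L x)‖` when the bonds of `V` on the order box `[L•blk_L x, x]` are within `b` of `1`).  §4 **`norm_nestedExt_sub_le`** (the tower, abstract
per-level box hypotheses `δ_i`, product form) and **`norm_nestedExt_sub_le_sum`** (`≤ 4d(L−1)(Σ_{i≤j} δ_i)·‖g‖` when `2d(L−1)Σδ_i ≤ 1∕2`, `NE3QbarIterNearFlat.prod_one_add_le`).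
HONEST FRAMING (page 1): kinematics of OUR nested extension; nothing of Bałaban's asserted; THE CURVED LETTER (L) IS NOT PROVED HERE (brick (C3) only); NOT (S1), NOT NE7; spine 0∕9; finite
T⁴ rung (B)+1 — NOT infinite volume, NOT mass gap, NOT BetaPertH, NOT Clay.  Continuum YM on T⁴ ⇐ BetaPertH ∧ nine spine estimates (0/9 proved); BetaPertH ⇐ (D1) ∧ (D4) ∧ CAP+tail; G-an2-4
gates asym, D1 and NE2/3/4.
-/

set_option autoImplicit false

open scoped BigOperators Matrix.Norms.L2Operator
open Finset

namespace Summit.QuantumFields.BalabanUV.T4Continuum.NE7NestedExtNearFlat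

open Literature.MathematicalPhysics.QuantumFieldTheory.Balaban1983to89
open B7Prop1Explicit B7Prop2Explicit
open T4AveragingDeficitWall (IsUnitaryCfg SmallField Ad)
open AveragingDeficitTransport (norm_Ad_of_unitary)
open AveragingDeficitNearIdentity (norm_Ad_sub_le)
open AveragingDeficitChartCalculus (cavg)
open AveragingDeficitMultiLevelPrep (cavgIter LevelSmall)
open T4AveragingDeficitNonAbelian (Ad_mul Ad_sub)
open NE3TangentCovariantTower (step_small)
open NE3NestedBlockMeanCovariance (cavg_gaugeAct norm_hol_treeWord_sub_one_le)
open NE3QbarNearFlat (norm_units_inv_sub_one_le')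
open NE3QbarIterNearFlat (prod_one_add_le)
open SmoothRefineBlocks (blk res blk_add_res res_nonneg res_le)
open NE7NestedCovariantExtension (covExt nestedExt nestedExt_succ nestedExt_zero)
open NE7EnergySliceSupFlatSite (blk_blk)

noncomputable section

variable {d : ℕ} {n : Type*} [Fintype n] [DecidableEq n]

/-! ## §1 Gauge covariance of the one-level extension -/

/-- **`covExt L (W^u) (Ad_{u(L•·)} f) x = Ad_{u x} (covExt L W f x)`** — the tree transport `W^u(Γ_{L•b,x}) = u(L•b)·W(Γ)·u(x)⁻¹` eats the dressing (any `u`, any `W`). [folklore] -/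
theorem covExt_gaugeAct (L : ℕ) (u : Site d → (Matrix n n ℂ)ˣ) (W : Site d → Fin d → (Matrix n n ℂ)ˣ) (f : Site d → Matrix n n ℂ) (x : Site d) :
    covExt L (gaugeAct u W) (fun z => Ad (u ((L : ℤ) • z)) (f z)) x = Ad (u x) (covExt L W f x) := by
  unfold covExt
  rw [hol_gaugeAct, disp_treeWord, blk_add_res, ← Ad_mul, ← Ad_mul]
  congr 1
  rw [mul_inv_rev, mul_inv_rev, inv_inv, mul_assoc, mul_assoc, inv_mul_cancel, mul_one]

/-! ## §2 Gauge covariance through the tower -/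

/-- **`nestedExt L (j+1) (W^u) (Ad_{u(L^{j+1}•·)} g) y = Ad_{u y} (nestedExt L (j+1) W g y)`** (multi-level small-field class at `W`, unitary `u`): the class is gauge invariant and persists
under averaging (`step_small`), and each level is `covExt_gaugeAct` ∘ `cavg_gaugeAct`. [folklore] -/
theorem nestedExt_gaugeAct [Nonempty n] {L : ℕ} (hL : 1 ≤ L) (j : ℕ) :
    ∀ {W : Site d → Fin d → (Matrix n n ℂ)ˣ} {x : ℝ}, IsUnitaryCfg W → 0 ≤ x → LevelSmall d L j x → SmallField W x →
    ∀ {u : Site d → (Matrix n n ℂ)ˣ}, (∀ y, u y ∈ unitaryUnits (Matrix n n ℂ)) →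
    ∀ (g : Site d → Matrix n n ℂ) (y : Site d),
      nestedExt L (j + 1) (gaugeAct u W) (fun z => Ad (u (((L ^ (j + 1) : ℕ) : ℤ) • z)) (g z)) y
        = Ad (u y) (nestedExt L (j + 1) W g y) := by
  induction j with
  | zero =>
      intro W x _ _ _ _ u _ g y
      rw [nestedExt_succ, nestedExt_zero, nestedExt_succ, nestedExt_zero]
      have e : (fun z => Ad (u (((L ^ (0 + 1) : ℕ) : ℤ) • z)) (g z)) = fun z => Ad (u ((L : ℤ) • z)) (g z) := by
        funext z; simp
      rw [e, covExt_gaugeAct]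
  | succ j ih =>
      intro W x hWu hx hsm hWx u hu g y
      obtain ⟨h512, hW₁u, hr0, hW₁x⟩ := step_small hL hWu hx hsm.1 hWx
      rw [nestedExt_succ, nestedExt_succ L (j + 1) W, cavg_gaugeAct hL hWu hx h512 hWx hu]
      have hfun : nestedExt L (j + 1) (gaugeAct (fun w => u ((L : ℤ) • w)) (cavg L W)) (fun z => Ad (u (((L ^ (j + 1 + 1) : ℕ) : ℤ) • z)) (g z))
          = fun w => Ad (u ((L : ℤ) • w)) (nestedExt L (j + 1) (cavg L W) g w) := by
        funext w
        have e : (fun z => Ad (u (((L ^ (j + 1 + 1) : ℕ) : ℤ) • z)) (g z))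
            = fun z => Ad ((fun w => u ((L : ℤ) • w)) (((L ^ (j + 1) : ℕ) : ℤ) • z)) (g z) := by
          funext z
          simp only [smul_smul]
          congr 3
          push_cast; ring
        rw [e]
        exact ih hW₁u hr0 hsm.2 hW₁x (fun y => hu _) g w
      rw [hfun, covExt_gaugeAct]

/-! ## §3 One level: the extension against the plain block constant -/

/-- **ONE LEVEL**: if the bonds of the unitary `V` on the order box `[L•blk_L x, x]` are within `b` of `1`, then `‖covExt L V f x − f (blk_L x)‖ ≤ 2·l1(res_L x)·b·‖f (blk_L x)‖`. [folklore] -/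
theorem norm_covExt_sub_le [Nonempty n] {L : ℕ} (hL : 1 ≤ L) {V : Site d → Fin d → (Matrix n n ℂ)ˣ} (hV : IsUnitaryCfg V) (f : Site d → Matrix n n ℂ)
    (x : Site d) {b : ℝ} (hb : ∀ (w : Site d) (ν : Fin d), (L : ℤ) • blk L x ≤ w → w + e ν ≤ x → ‖((V w ν : (Matrix n n ℂ)ˣ) : Matrix n n ℂ) - 1‖ ≤ b) :
    ‖covExt L V f x - f (blk L x)‖ ≤ 2 * ((l1 (res L x) : ℝ) * b) * ‖f (blk L x)‖ := by
  have hhol := norm_hol_treeWord_sub_one_le hV (lo := (L : ℤ) • blk L x) (hi := x) hb (p := (L : ℤ) • blk L x) (v := res L x)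
    (res_nonneg hL x) le_rfl (le_of_eq (blk_add_res L x))
  have hu : hol V ((L : ℤ) • blk L x) (treeWord (res L x)) ∈ unitaryUnits (Matrix n n ℂ) := hol_mem_of hV _ _
  have hui : (hol V ((L : ℤ) • blk L x) (treeWord (res L x)))⁻¹ ∈ unitaryUnits (Matrix n n ℂ) := (unitaryUnits _).inv_mem hu
  unfold covExt
  refine (norm_Ad_sub_le hui _).trans ?_
  have hinv : ‖(((hol V ((L : ℤ) • blk L x) (treeWord (res L x)))⁻¹ : (Matrix n n ℂ)ˣ) : Matrix n n ℂ) - 1‖ ≤ (l1 (res L x) : ℝ) * b :=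
    (norm_units_inv_sub_one_le' hu).trans hhol
  exact mul_le_mul_of_nonneg_right (mul_le_mul_of_nonneg_left hinv (by norm_num)) (norm_nonneg _)

/-! ## §4 The tower: the nested extension against the plain block constant -/

/-- **THE NESTED EXTENSION AT A NEAR-FLAT TOWER** (multi-level small-field class at the unitary `V`): if for every `i ≤ j` the bonds of the `i`-fold average `cavgIter L i V` on the order box
`[L•blk_L y_i, y_i]`, `y_i = blk_{L^i} y`, are within `δ_i ≥ 0` of `1`, then `‖nestedExt L (j+1) V g y − g (blk_{L^{j+1}} y)‖ ≤ (Π_{i<j+1} (1 + 2d(L−1)·δ_i) − 1)·‖g (blk_{L^{j+1}} y)‖`. [folklore] -/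
theorem norm_nestedExt_sub_le [Nonempty n] {L : ℕ} (hL : 1 ≤ L) (j : ℕ) :
    ∀ {V : Site d → Fin d → (Matrix n n ℂ)ˣ} {x : ℝ}, IsUnitaryCfg V → 0 ≤ x → LevelSmall d L j x → SmallField V x →
    ∀ (g : Site d → Matrix n n ℂ) (y : Site d) {δ : ℕ → ℝ}, (∀ i, 0 ≤ δ i) →
    (∀ i, i ≤ j → ∀ (w : Site d) (ν : Fin d), (L : ℤ) • blk L (blk (L ^ i) y) ≤ w → w + e ν ≤ blk (L ^ i) y →
        ‖((cavgIter L i V w ν : (Matrix n n ℂ)ˣ) : Matrix n n ℂ) - 1‖ ≤ δ i) →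
      ‖nestedExt L (j + 1) V g y - g (blk (L ^ (j + 1)) y)‖
        ≤ ((∏ i ∈ Finset.range (j + 1), (1 + 2 * ((d : ℝ) * ((L : ℝ) - 1)) * δ i)) - 1) * ‖g (blk (L ^ (j + 1)) y)‖ := by
  have hl1 : ∀ z : Site d, (l1 (res L z) : ℝ) ≤ d * ((L : ℝ) - 1) := fun z =>
    NE7MeanZeroGaugeSupPoincare.l1_le_of_box (M := L) (res L z) (res_nonneg hL z) (res_le hL z)
  have hc0 : 0 ≤ (d : ℝ) * ((L : ℝ) - 1) := by
    have : (1 : ℝ) ≤ L := by exact_mod_cast hL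
    exact mul_nonneg (Nat.cast_nonneg _) (by linarith)
  -- one level, from the box hypothesis at level `0`
  have hone : ∀ {V : Site d → Fin d → (Matrix n n ℂ)ˣ}, IsUnitaryCfg V → ∀ (f : Site d → Matrix n n ℂ) (y : Site d) {b : ℝ}, 0 ≤ b →
      (∀ (w : Site d) (ν : Fin d), (L : ℤ) • blk L y ≤ w → w + e ν ≤ y → ‖((V w ν : (Matrix n n ℂ)ˣ) : Matrix n n ℂ) - 1‖ ≤ b) →
      ‖covExt L V f y - f (blk L y)‖ ≤ 2 * ((d : ℝ) * ((L : ℝ) - 1)) * b * ‖f (blk L y)‖ := by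
    intro V hVu f y b hb0 hb
    refine (norm_covExt_sub_le hL hVu f y hb).trans ?_
    have h0 : 0 ≤ ‖f (blk L y)‖ := norm_nonneg _
    have h1 : (l1 (res L y) : ℝ) * b ≤ (d : ℝ) * ((L : ℝ) - 1) * b := mul_le_mul_of_nonneg_right (hl1 y) hb0
    nlinarith
  induction j with
  | zero =>
      intro V x hVu _ _ _ g y δ hδ0 hδ
      rw [nestedExt_succ, nestedExt_zero, Finset.prod_range_one, zero_add, pow_one]
      have hb1 : blk 1 y = y := by funext i; simp [blk]
      have hb : ∀ (w : Site d) (ν : Fin d), (L : ℤ) • blk L y ≤ w → w + e ν ≤ y → ‖((V w ν : (Matrix n n ℂ)ˣ) : Matrix n n ℂ) - 1‖ ≤ δ 0 := by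
        intro w ν h1 h2
        have := hδ 0 le_rfl w ν
        rw [pow_zero, hb1] at this
        exact this h1 h2
      have := hone hVu g y (hδ0 0) hb
      linarith
  | succ j ih =>
      intro V x hVu hx hsm hVx g y δ hδ0 hδ
      obtain ⟨-, hV₁u, hr0, hV₁x⟩ := step_small hL hVu hx hsm.1 hVx
      rw [nestedExt_succ]
      -- the outermost level
      have hb1 : blk 1 y = y := by funext i; simp [blk]
      have hb : ∀ (w : Site d) (ν : Fin d), (L : ℤ) • blk L y ≤ w → w + e ν ≤ y → ‖((V w ν : (Matrix n n ℂ)ˣ) : Matrix n n ℂ) - 1‖ ≤ δ 0 := by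
        intro w ν h1 h2
        have := hδ 0 (Nat.zero_le _) w ν
        rw [pow_zero, hb1] at this
        exact this h1 h2
      have hout := hone hVu (nestedExt L (j + 1) (cavg L V) g) y (hδ0 0) hb
      -- the inner levels, at the averaged background, read at `blk_L y`
      have hin := ih hV₁u hr0 hsm.2 hV₁x g (blk L y) (δ := fun i => δ (i + 1)) (fun i => hδ0 _) (fun i hi w ν h1 h2 => by
        have := hδ (i + 1) (by omega) w ν
        rw [← blk_blk L i y] at this
        exact this h1 h2)
      rw [blk_blk L (j + 1) y] at hin
      -- combine
      set G : ℝ := ‖g (blk (L ^ (j + 1 + 1)) y)‖ with hG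
      set P' : ℝ := ∏ i ∈ Finset.range (j + 1), (1 + 2 * ((d : ℝ) * ((L : ℝ) - 1)) * δ (i + 1)) with hP'
      have hP1 : 1 ≤ P' := by
        rw [hP']
        calc (1 : ℝ) = ∏ _i ∈ Finset.range (j + 1), (1 : ℝ) := by simp
          _ ≤ _ := Finset.prod_le_prod (fun _ _ => zero_le_one) fun i _ => by
                have := hδ0 (i + 1); nlinarith
      have hprod : ∏ i ∈ Finset.range (j + 1 + 1), (1 + 2 * ((d : ℝ) * ((L : ℝ) - 1)) * δ i)
          = (1 + 2 * ((d : ℝ) * ((L : ℝ) - 1)) * δ 0) * P' := by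
        rw [Finset.prod_range_succ', hP', mul_comm]
      rw [hprod]
      have hG0 : 0 ≤ G := norm_nonneg _
      have hh : ‖nestedExt L (j + 1) (cavg L V) g (blk L y)‖ ≤ G + (P' - 1) * G := by
        have e : nestedExt L (j + 1) (cavg L V) g (blk L y) = (nestedExt L (j + 1) (cavg L V) g (blk L y) - g (blk (L ^ (j + 1 + 1)) y)) + g (blk (L ^ (j + 1 + 1)) y) := by
          abel
        rw [e]
        exact (norm_add_le _ _).trans (by linarith [hin])
      have htri : ‖covExt L V (nestedExt L (j + 1) (cavg L V) g) y - g (blk (L ^ (j + 1 + 1)) y)‖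
          ≤ ‖covExt L V (nestedExt L (j + 1) (cavg L V) g) y - nestedExt L (j + 1) (cavg L V) g (blk L y)‖
            + ‖nestedExt L (j + 1) (cavg L V) g (blk L y) - g (blk (L ^ (j + 1 + 1)) y)‖ := by
        have e : covExt L V (nestedExt L (j + 1) (cavg L V) g) y - g (blk (L ^ (j + 1 + 1)) y)
            = (covExt L V (nestedExt L (j + 1) (cavg L V) g) y - nestedExt L (j + 1) (cavg L V) g (blk L y))
              + (nestedExt L (j + 1) (cavg L V) g (blk L y) - g (blk (L ^ (j + 1 + 1)) y)) := by abel
        rw [e]; exact norm_add_le _ _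
      have hcδ : 0 ≤ 2 * ((d : ℝ) * ((L : ℝ) - 1)) * δ 0 := by have := hδ0 0; positivity
      have step1 : ‖covExt L V (nestedExt L (j + 1) (cavg L V) g) y - nestedExt L (j + 1) (cavg L V) g (blk L y)‖
          ≤ 2 * ((d : ℝ) * ((L : ℝ) - 1)) * δ 0 * (G + (P' - 1) * G) := hout.trans (mul_le_mul_of_nonneg_left hh hcδ)
      calc _ ≤ 2 * ((d : ℝ) * ((L : ℝ) - 1)) * δ 0 * (G + (P' - 1) * G) + (P' - 1) * G := htri.trans (add_le_add step1 hin)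
        _ = ((1 + 2 * ((d : ℝ) * ((L : ℝ) - 1)) * δ 0) * P' - 1) * G := by ring

/-- **THE SUM FORM**: under `2d(L−1)·Σ_{i<j+1} δ_i ≤ 1∕2` the product bound is at most `4d(L−1)·(Σ_{i<j+1} δ_i)·‖g(blk y)‖` (`NE3QbarIterNearFlat.prod_one_add_le`). [folklore] -/
theorem norm_nestedExt_sub_le_sum [Nonempty n] {L : ℕ} (hL : 1 ≤ L) (j : ℕ) {V : Site d → Fin d → (Matrix n n ℂ)ˣ} {x : ℝ}
    (hVu : IsUnitaryCfg V) (hx : 0 ≤ x) (hs : LevelSmall d L j x) (hVx : SmallField V x)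
    (g : Site d → Matrix n n ℂ) (y : Site d) {δ : ℕ → ℝ} (hδ0 : ∀ i, 0 ≤ δ i)
    (hδ : ∀ i, i ≤ j → ∀ (w : Site d) (ν : Fin d), (L : ℤ) • blk L (blk (L ^ i) y) ≤ w → w + e ν ≤ blk (L ^ i) y →
        ‖((cavgIter L i V w ν : (Matrix n n ℂ)ˣ) : Matrix n n ℂ) - 1‖ ≤ δ i)
    (hsum : 2 * ((d : ℝ) * ((L : ℝ) - 1)) * ∑ i ∈ Finset.range (j + 1), δ i ≤ 1 / 2) :
    ‖nestedExt L (j + 1) V g y - g (blk (L ^ (j + 1)) y)‖ ≤ 4 * ((d : ℝ) * ((L : ℝ) - 1)) * (∑ i ∈ Finset.range (j + 1), δ i) * ‖g (blk (L ^ (j + 1)) y)‖ := by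
  have hc0 : 0 ≤ (d : ℝ) * ((L : ℝ) - 1) := by
    have : (1 : ℝ) ≤ L := by exact_mod_cast hL
    exact mul_nonneg (Nat.cast_nonneg _) (by linarith)
  have h := norm_nestedExt_sub_le hL j hVu hx hs hVx g y hδ0 hδ
  have hp := prod_one_add_le (fun i => 2 * ((d : ℝ) * ((L : ℝ) - 1)) * δ i) (fun i => by have := hδ0 i; positivity) (j + 1)
    (by rw [← Finset.mul_sum]; exact hsum)
  rw [← Finset.mul_sum] at hp
  refine h.trans (mul_le_mul_of_nonneg_right ?_ (norm_nonneg _))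
  linarith

end

end Summit.QuantumFields.BalabanUV.T4Continuum.NE7NestedExtNearFlat
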